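import Summits.HubbardSuperconductivity.HubbardSuperconductivity.Theses.BcsKacWindow
import Literature.MathematicalPhysics.QuantumLattice.FreeFermionSectorGroundStates
import Literature.MathematicalPhysics.QuantumLattice.FreeFermiGasPairGramBounds
import Literature.Barriers.HubbardSuperconductivity.PureModelStripeCompetitionProofs

/-!
# Crux `CoherenceWindowLRO` (item `stmt-HubbardSuperconductivity-1319`): load-bearing hypotheses

Negative-side calibration lemmas for the rank-2 crux `CoherenceWindowLRO` of route `BcsKacWindow`
(`Summits/…/Theses/BcsKacWindow.lean`), written by the line lead in the slot of the (never seated)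
standing disprover; sorry-free, no definition introduced — every mutated statement is spelled out
verbatim. The crux asks for a doping window `[a,b] ⊂ (0,1/2)`, a gap scale `Δ(U)` pinned between
`e^{-κ₂/U²}` and `e^{-κ₁/U²}`, and constants `c₀, s₀ > 0` such that FOR EVERY window top `s ≥ s₀`
there is `U₁(s) > 0` with: for `δ ∈ [a,b]`, `U ∈ (0,U₁)`, every even `L` with
`s₀ ≤ Δ(U)·L ≤ s` and every normalised `(2⌊(1-δ)L²/2⌋, S^z = 0)`-sector ground state `ψ` of
`hubbardTorus 2 L 1 U`, `c₀ Δ(U)² ≤ L⁻⁴ Re⟨ψ, Δ_d† Δ_d ψ⟩`; the constant `c₀` is uniform in `s`.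

* `false_without_interaction` — with `hubbardTorus 2 L 1 U` replaced by the FREE torus
  `hubbardTorus 2 L 1 0` in the ground-state clause (pins, window, sector, normalisation and the
  `s`-uniform `c₀` all kept) the statement is FALSE: the paired Fermi sea
  `Π_{k∈F} c†_{k↑}c†_{-k↓}|0⟩` over a set `F` of `⌊(1-δ)L²/2⌋` lowest band levels is a normalised
  free sector ground state (`isGroundStateInSector_pairedState_free`) with sharp Bloch occupations,
  so the pair Gram bound `re_expect_pairField_dWave_le` leaves only the diagonal background
  `Re⟨Δ_d†Δ_d⟩ ≤ 32 L²` (`re_expect_pairField_dWave_le_of_sharp`); at the top of a window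
  `s₀ ≤ Δ(U)L ≤ s` this is `< c₀ Δ² L⁴` once `(ΔL)² > 32/c₀`, and wide windows are inhabited by
  long even tori once `U` is small (`exists_even_side_in_upper_window`, upper pin alone). This is
  the precise sense of the route's remark "c₀ uniform in s defeats the free-gas background C/L²":
  any proof of the crux must use `U > 0` (below `Literature.Barriers.….WeakCouplingCeiling`).
* `false_without_groundState` — with "ground state of `hubbardTorus 2 L 1 U` in the sector"
  weakened to "unit vector of the sector" the statement is FALSE at every coupling: the same
  paired sea lies in the sector (`pairedState_mem_szSector`) and carries only the `L²` background.
* `false_without_normalisation` — without `star ψ ⬝ᵥ ψ = 1` it is FALSE: sector ground states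
  exist and form a cone (`exists_unit_isGroundStateInSector_hubbardTorus`,
  `isGroundStateInSector_smul`), and `Re⟨tψ, Δ_d†Δ_d (tψ)⟩ = t² Re⟨ψ, Δ_d†Δ_d ψ⟩ → 0`.
* `loadBearingInteraction` — the one-line registered form of `false_without_interaction`
  (stub of crux `stmt-HubbardSuperconductivity-1319`, line `birth`).

Not here: anything about the crux itself (open; neither it nor its negation is claimed) or about
the standing design objection (`Δ` pinned independently of `δ` over `a < b`; refuters' repair F1).

Sources: Bardeen–Cooper–Schrieffer, Phys. Rev. 108 (1957) 1175, §II; C. N. Yang, Rev. Mod.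
Phys. 34 (1962) 694, §3 (no ODLRO for free fermions); E. H. Lieb, PRL 62 (1989) 1201 (the `(n,n)`
sector); D. J. Scalapino, Phys. Rep. 250 (1995) 329, §2 (the pair field). Folklore otherwise.
Tree: `re_expect_pairField_dWave_le`, `momentumNumber_down_pairedState_of_mem/not_mem`,
`star_pairedState_dotProduct_self`, `isGroundStateInSector_pairedState_free`, `exists_fermiSet`,
`pairedState_mem_szSector`, `exists_unit_isGroundStateInSector_hubbardTorus`,
`isGroundStateInSector_smul`, `natFloor_filling_le_sq`; Mathlib: `Nat.floor_le`,
`Nat.lt_floor_add_one`, `Real.exp_lt_exp`, `Real.exp_log`, `Real.sq_sqrt`.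
-/

-- the mandated namespace `Summit.<Summit>.<Problem>.Theorems…` repeats `HubbardSuperconductivity`
-- (single-problem summit, D-0017), which the `dupNamespace` linter flags on every declaration
set_option linter.dupNamespace false

noncomputable section

namespace Summit.HubbardSuperconductivity.HubbardSuperconductivity.Theorems.CoherenceWindowLRO.Negative

open Matrix
open Literature.Probability.LatticeModels Literature.MathematicalPhysics.QuantumLattice
open Literature.Barriers.HubbardSuperconductivity

/-! ### Sharp Bloch occupations leave only the `L²` background -/

section Sharp

variable {L : ℕ} [NeZero L]

/-- **Sharp `↓`-occupations kill the pair Gram means**: if `n_{-k↓} Φ = Φ` or `n_{-k↓} Φ = 0`,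
then one of the pair-present / pair-absent expectations `u_k = Re⟨Φ, n_{k↑}n_{-k↓} Φ⟩`,
`v_k = Re⟨Φ, (1-n_{k↑})(1-n_{-k↓}) Φ⟩` vanishes, so `u_k v_k = 0`. Bardeen–Cooper–Schrieffer
(1957) §II. [folklore] -/
theorem pairPresent_mul_pairAbsent_eq_zero_of_sharp {Φ : Fock (Orb (FermionTorus 2 L))}
    (k : TorusSite 2 L) (h : momentumNumber (-k) 1 *ᵥ Φ = Φ ∨ momentumNumber (-k) 1 *ᵥ Φ = 0) :
    (star Φ ⬝ᵥ ((momentumNumber k 0 * momentumNumber (-k) 1) *ᵥ Φ)).re *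
      (star Φ ⬝ᵥ (((1 - momentumNumber k 0) * (1 - momentumNumber (-k) 1)) *ᵥ Φ)).re = 0 := by
  rcases h with hk | hk
  · have hinner : (1 - momentumNumber (-k) 1) *ᵥ Φ = 0 := by
      rw [sub_mulVec, one_mulVec, hk, sub_self]
    have h0 : ((1 - momentumNumber k 0) * (1 - momentumNumber (-k) 1)) *ᵥ Φ = 0 := by
      rw [← mulVec_mulVec, hinner, mulVec_zero]
    rw [h0, dotProduct_zero, Complex.zero_re, mul_zero]
  · have h0 : (momentumNumber k 0 * momentumNumber (-k) 1) *ᵥ Φ = 0 := by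
      rw [← mulVec_mulVec, hk, mulVec_zero]
    rw [h0, dotProduct_zero, Complex.zero_re, zero_mul]

/-- **A unit vector with sharp `↓`-occupations has only the `L²` pair background**:
`Re⟨Φ, Δ_d† Δ_d Φ⟩ ≤ 32 L²` (the pair Gram bound `re_expect_pairField_dWave_le` with all quartic
means `t_k = (u_k v_k)^{1/4}` equal to `0`). Applies to every paired sea
`Π_{k∈l} c†_{k↑}c†_{-k↓}|0⟩` (`momentumNumber_down_pairedState_of_mem / _of_not_mem`), in
particular to the free Fermi sea: `L⁻⁴ Re⟨Δ_d†Δ_d⟩ ≤ 32/L²`, no `d`-wave pair LRO.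
Bardeen–Cooper–Schrieffer (1957) §II; Yang (1962) §3. [folklore] -/
theorem re_expect_pairField_dWave_le_of_sharp {Φ : Fock (Orb (FermionTorus 2 L))}
    (h1 : star Φ ⬝ᵥ Φ = 1)
    (h : ∀ k : TorusSite 2 L, momentumNumber (-k) 1 *ᵥ Φ = Φ ∨ momentumNumber (-k) 1 *ᵥ Φ = 0) :
    (expect ((pairField dWaveFormFactor L)ᴴ * pairField dWaveFormFactor L) Φ).re ≤
      32 * (L : ℝ) ^ 2 := by
  have hle := re_expect_pairField_dWave_le Φ h1
  have hsum : ∑ k : TorusSite 2 L, Real.sqrt (Real.sqrt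
      ((star Φ ⬝ᵥ ((momentumNumber k 0 * momentumNumber (-k) 1) *ᵥ Φ)).re *
        (star Φ ⬝ᵥ (((1 - momentumNumber k 0) * (1 - momentumNumber (-k) 1)) *ᵥ Φ)).re)) = 0 := by
    refine Finset.sum_eq_zero fun k _ => ?_
    rw [pairPresent_mul_pairAbsent_eq_zero_of_sharp k (h k), Real.sqrt_zero, Real.sqrt_zero]
  rw [hsum] at hle
  unfold expect
  linarith

/-- The paired sea `Π_{k∈l} c†_{k↑}c†_{-k↓}|0⟩` has sharp `↓`-occupations. [folklore] -/
theorem momentumNumber_down_pairedState_sharp (l : List (TorusSite 2 L)) (k : TorusSite 2 L) :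
    momentumNumber (-k) 1 *ᵥ ((l.map fun q : TorusSite 2 L => (pairMode q)ᴴ).prod *ᵥ
        (vacuum : Fock (Orb (FermionTorus 2 L)))) =
      (l.map fun q : TorusSite 2 L => (pairMode q)ᴴ).prod *ᵥ (vacuum : Fock (Orb (FermionTorus 2 L))) ∨
    momentumNumber (-k) 1 *ᵥ ((l.map fun q : TorusSite 2 L => (pairMode q)ᴴ).prod *ᵥ
        (vacuum : Fock (Orb (FermionTorus 2 L)))) = 0 := by
  by_cases hk : k ∈ l
  · exact Or.inl (momentumNumber_down_pairedState_of_mem hk)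
  · exact Or.inr (momentumNumber_down_pairedState_of_not_mem hk)

/-- **A normalised free sector ground state with only the background**, at every admissible
filling: for `L ≥ 3` and `n ≤ L²` there is a unit vector `ψ` of the fermionic torus which is a
ground state of the FREE torus `hubbardTorus 2 L 1 0` in the sector `(2n, S^z = 0)` and has
`Re⟨ψ, Δ_d†Δ_d ψ⟩ ≤ 32 L²` (the paired sea over a Fermi set of `n` lowest band levels,
`exists_fermiSet`, `isGroundStateInSector_pairedState_free`). [folklore] -/
theorem exists_unit_free_groundState_pairDensity_le (hL : 3 ≤ L) {n : ℕ} (hn : n ≤ L ^ 2) :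
    ∃ ψ : Fock (Orb (FermionTorus 2 L)), star ψ ⬝ᵥ ψ = 1 ∧
      IsGroundStateInSector (hubbardTorus 2 L 1 0) (2 * n) 0 ψ ∧
        (expect ((pairField dWaveFormFactor L)ᴴ * pairField dWaveFormFactor L) ψ).re ≤
          32 * (L : ℝ) ^ 2 := by
  classical
  have hn' : n ≤ Fintype.card (TorusSite 2 L) := by rwa [card_torusSite]
  obtain ⟨F, eF, hFc, hF, hF'⟩ := exists_fermiSet (torusBand L) hn'
  refine ⟨(F.toList.map fun q : TorusSite 2 L => (pairMode q)ᴴ).prod *ᵥ vacuum,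
    star_pairedState_dotProduct_self F.nodup_toList, ?_,
    re_expect_pairField_dWave_le_of_sharp (star_pairedState_dotProduct_self F.nodup_toList)
      (momentumNumber_down_pairedState_sharp F.toList)⟩
  rw [← hFc]
  exact isGroundStateInSector_pairedState_free hL F eF hF hF'

/-- **A normalised sector vector with only the background**, at every filling `n ≤ L²` and every
side: the paired sea over any `n` momenta lies in `szSector (2n) 0` (`pairedState_mem_szSector`),
is a unit vector, and has `Re⟨ψ, Δ_d†Δ_d ψ⟩ ≤ 32 L²`. [folklore] -/
theorem exists_unit_sector_state_pairDensity_le {n : ℕ} (hn : n ≤ L ^ 2) :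
    ∃ ψ : Fock (Orb (FermionTorus 2 L)), star ψ ⬝ᵥ ψ = 1 ∧
      ψ ∈ szSector (Λ := FermionTorus 2 L) (2 * n) 0 ∧
        (expect ((pairField dWaveFormFactor L)ᴴ * pairField dWaveFormFactor L) ψ).re ≤
          32 * (L : ℝ) ^ 2 := by
  classical
  obtain ⟨F, -, hFc⟩ := Finset.exists_subset_card_eq (s := (Finset.univ : Finset (TorusSite 2 L)))
    (n := n) (by rwa [Finset.card_univ, card_torusSite])
  refine ⟨(F.toList.map fun q : TorusSite 2 L => (pairMode q)ᴴ).prod *ᵥ vacuum,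
    star_pairedState_dotProduct_self F.nodup_toList, ?_,
    re_expect_pairField_dWave_le_of_sharp (star_pairedState_dotProduct_self F.nodup_toList)
      (momentumNumber_down_pairedState_sharp F.toList)⟩
  have h := pairedState_mem_szSector (L := L) F.toList
  rwa [Finset.length_toList, hFc] at h

end Sharp


/-! ### Wide windows are inhabited by long even tori -/

/-- `e^{-κ/U²} → 0` as `U → 0⁺`, in `ε`-form: for `κ, ε > 0` there is `U₀ > 0` with
`e^{-κ/U²} < ε` whenever `0 < U < U₀` (take `U₀ = √(κ / max 1 (-log ε))`). [folklore] -/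
theorem exists_pos_exp_neg_div_sq_lt {κ ε : ℝ} (hκ : 0 < κ) (hε : 0 < ε) :
    ∃ U₀ : ℝ, 0 < U₀ ∧ ∀ U : ℝ, 0 < U → U < U₀ → Real.exp (-(κ / U ^ 2)) < ε := by
  set M : ℝ := max 1 (-Real.log ε) with hM
  have hMpos : 0 < M := lt_of_lt_of_le one_pos (le_max_left _ _)
  refine ⟨Real.sqrt (κ / M), Real.sqrt_pos.2 (div_pos hκ hMpos), fun U hU hUlt => ?_⟩
  have hU2 : U ^ 2 < κ / M := by
    have h1 : U ^ 2 < Real.sqrt (κ / M) ^ 2 := pow_lt_pow_left₀ hUlt hU.le two_ne_zero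
    rwa [Real.sq_sqrt (div_pos hκ hMpos).le] at h1
  have hU2pos : 0 < U ^ 2 := by positivity
  have hdiv : M < κ / U ^ 2 := by
    rw [lt_div_iff₀ hU2pos]
    calc M * U ^ 2 < M * (κ / M) := mul_lt_mul_of_pos_left hU2 hMpos
      _ = κ := mul_div_cancel₀ κ hMpos.ne'
  calc Real.exp (-(κ / U ^ 2)) < Real.exp (Real.log ε) := by
        apply Real.exp_lt_exp.2
        have : -Real.log ε ≤ M := le_max_right _ _
        linarith
    _ = ε := Real.exp_log hε

/-- **Wide windows are inhabited by long even tori, near their top.** If `0 < Δ(U) ≤ e^{-κ₁/U²}`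
for `U > 0` (`κ₁ > 0`), then for every `s > 0` and `U₁ > 0` there are a coupling `U ∈ (0, U₁)` and
an even side `2m` with `m ≥ 2`, `Δ(U)·2m ≤ s` and `3s/4 < Δ(U)·2m` (choose `U` with
`Δ(U) < s/8` and `m = ⌊s / (2Δ(U))⌋`). So a window `s₀ ≤ Δ(U) L ≤ s` with `s ≥ 2 s₀` contains an
even torus in its upper quarter for some admissible `U`, however small `U₁` is. [folklore] -/
theorem exists_even_side_in_upper_window {κ₁ : ℝ} {Δ : ℝ → ℝ} (hκ₁ : 0 < κ₁)
    (hpin : ∀ U : ℝ, 0 < U → 0 < Δ U ∧ Δ U ≤ Real.exp (-(κ₁ / U ^ 2)))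
    {s : ℝ} (hs : 0 < s) {U₁ : ℝ} (hU₁ : 0 < U₁) :
    ∃ U : ℝ, 0 < U ∧ U < U₁ ∧ ∃ m : ℕ, 2 ≤ m ∧
      Δ U * ((2 * m : ℕ) : ℝ) ≤ s ∧ 3 * s / 4 < Δ U * ((2 * m : ℕ) : ℝ) := by
  obtain ⟨U₀, hU₀, hsmall⟩ := exists_pos_exp_neg_div_sq_lt hκ₁ (show 0 < s / 8 by positivity)
  set U : ℝ := min (U₁ / 2) (U₀ / 2) with hUdef
  have hUpos : 0 < U := lt_min (by positivity) (by positivity)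
  have hUU₁ : U < U₁ := lt_of_le_of_lt (min_le_left _ _) (by linarith)
  have hUU₀ : U < U₀ := lt_of_le_of_lt (min_le_right _ _) (by linarith)
  obtain ⟨hDpos, hDle⟩ := hpin U hUpos
  have hD : Δ U < s / 8 := lt_of_le_of_lt hDle (hsmall U hUpos hUU₀)
  set D : ℝ := Δ U with hDdef
  set m : ℕ := ⌊s / (2 * D)⌋₊ with hmdef
  have hx0 : 0 ≤ s / (2 * D) := by positivity
  have hmle : (m : ℝ) ≤ s / (2 * D) := Nat.floor_le hx0
  have hmgt : s / (2 * D) < (m : ℝ) + 1 := Nat.lt_floor_add_one _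
  have hbig : 4 < s / (2 * D) := by
    rw [lt_div_iff₀ (by positivity)]
    linarith
  refine ⟨U, hUpos, hUU₁, m, ?_, ?_, ?_⟩
  · have h3 : (3 : ℝ) < m := by linarith
    have h3' : 3 < m := by exact_mod_cast h3
    omega
  · have h1 : D * (2 * (m : ℝ)) ≤ D * (2 * (s / (2 * D))) :=
      mul_le_mul_of_nonneg_left (by linarith) hDpos.le
    have h2 : D * (2 * (s / (2 * D))) = s := by field_simp
    push_cast
    linarith
  · have h1 : D * (2 * (s / (2 * D) - 1)) < D * (2 * (m : ℝ)) := by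
      apply mul_lt_mul_of_pos_left _ hDpos
      linarith
    have h2 : D * (2 * (s / (2 * D) - 1)) = s - 2 * D := by field_simp
    push_cast
    linarith

/-! ### A window datum beating every `L²` background -/

/-- **A window datum that beats any `L²` background.** From the upper pin and `s₀, c₀ > 0`
alone: with the window top `s⋆ = max (2s₀) (1 + 32/c₀)` one has `s₀ ≤ s⋆`, and for every
`U₁ > 0` there are a coupling `U ∈ (0,U₁)` and an even side `2m` (`m ≥ 2`) inside the window
`s₀ ≤ Δ(U)·2m ≤ s⋆` such that NO real `P ≤ 32·(2m)²` satisfies `c₀ Δ(U)² ≤ P/(2m)⁴`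
(`exists_even_side_in_upper_window` puts `Δ(U)·2m` above `3s⋆/4`, and
`(3s⋆/4)² ≥ (9/16)(1 + 32/c₀)² ≥ 72/c₀ > 32/c₀`). [folklore] -/
theorem exists_window_datum {κ₁ s₀ c₀ : ℝ} {Δ : ℝ → ℝ} (hκ₁ : 0 < κ₁) (hs₀ : 0 < s₀) (hc₀ : 0 < c₀)
    (hpin : ∀ U : ℝ, 0 < U → 0 < Δ U ∧ Δ U ≤ Real.exp (-(κ₁ / U ^ 2))) :
    s₀ ≤ max (2 * s₀) (1 + 32 / c₀) ∧ ∀ U₁ : ℝ, 0 < U₁ → ∃ U : ℝ, 0 < U ∧ U < U₁ ∧ ∃ m : ℕ, 2 ≤ m ∧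
      s₀ ≤ Δ U * ((2 * m : ℕ) : ℝ) ∧ Δ U * ((2 * m : ℕ) : ℝ) ≤ max (2 * s₀) (1 + 32 / c₀) ∧
      ∀ P : ℝ, P ≤ 32 * ((2 * m : ℕ) : ℝ) ^ 2 → ¬ c₀ * Δ U ^ 2 ≤ P / ((2 * m : ℕ) : ℝ) ^ 4 := by
  set s : ℝ := max (2 * s₀) (1 + 32 / c₀) with hsdef
  have hs₀s : s₀ ≤ s := le_trans (by linarith) (le_max_left _ _)
  have hspos : 0 < s := lt_of_lt_of_le hs₀ hs₀s
  refine ⟨hs₀s, fun U₁ hU₁ => ?_⟩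
  obtain ⟨U, hUpos, hUU₁, m, hm2, hhi, hlo⟩ := exists_even_side_in_upper_window hκ₁ hpin hspos hU₁
  have hs₀L : s₀ ≤ Δ U * ((2 * m : ℕ) : ℝ) := by
    have : 2 * s₀ ≤ s := le_max_left _ _
    linarith
  refine ⟨U, hUpos, hUU₁, m, hm2, hs₀L, hhi, fun P hP key => ?_⟩
  have hL4 : (0 : ℝ) < ((2 * m : ℕ) : ℝ) ^ 4 := by positivity
  rw [le_div_iff₀ hL4] at key
  have h32 : c₀ * (Δ U * ((2 * m : ℕ) : ℝ)) ^ 2 ≤ 32 := by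
    have h2 : c₀ * (Δ U * ((2 * m : ℕ) : ℝ)) ^ 2 * ((2 * m : ℕ) : ℝ) ^ 2 ≤
        32 * ((2 * m : ℕ) : ℝ) ^ 2 := by
      calc c₀ * (Δ U * ((2 * m : ℕ) : ℝ)) ^ 2 * ((2 * m : ℕ) : ℝ) ^ 2
          = c₀ * Δ U ^ 2 * ((2 * m : ℕ) : ℝ) ^ 4 := by ring
        _ ≤ 32 * ((2 * m : ℕ) : ℝ) ^ 2 := key.trans hP
    exact le_of_mul_le_mul_right h2 (by positivity)
  have hbig : 1 + 32 / c₀ ≤ s := le_max_right _ _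
  have h72 : 32 / c₀ < (Δ U * ((2 * m : ℕ) : ℝ)) ^ 2 := by
    have hx : 0 ≤ 32 / c₀ := by positivity
    nlinarith [hlo, hbig, hx]
  have : 32 < c₀ * (Δ U * ((2 * m : ℕ) : ℝ)) ^ 2 := by
    have := mul_lt_mul_of_pos_left h72 hc₀
    rwa [mul_div_cancel₀ _ hc₀.ne'] at this
  linarith

/-! ### The interaction is load-bearing: the free torus violates the window statement -/

/-- **`CoherenceWindowLRO` is false for the free torus (the interaction is load-bearing).** The
body of the crux with `hubbardTorus 2 L 1 U` replaced by the free torus `hubbardTorus 2 L 1 0` in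
the ground-state clause — pins `e^{-κ₂/U²} ≤ Δ(U) ≤ e^{-κ₁/U²}`, window `s₀ ≤ Δ(U)L ≤ s`,
sector `(2⌊(1-δ)L²/2⌋, S^z=0)`, normalisation and the `s`-UNIFORM constant `c₀` all kept
verbatim — is FALSE. Proof: at the window top `s⋆ = max (2s₀) (1 + 32/c₀)` take the `U₁(s⋆)`
the statement provides, `δ = a`, the datum `(U, 2m)` of `exists_window_datum`, and the paired
Fermi sea of the sector: a normalised FREE ground state with `Re⟨Δ_d†Δ_d⟩ ≤ 32(2m)²`
(`exists_unit_free_groundState_pairDensity_le`), which the statement would force above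
`c₀ Δ(U)² (2m)⁴`. This is the content of the route's remark "`c₀` uniform in `s` defeats the
free-gas background `C/L²`": a proof of the crux must use `U > 0`.
Bardeen–Cooper–Schrieffer (1957) §II; Yang (1962) §3. [folklore] -/
theorem false_without_interaction :
    ¬ ∃ (a b κ₁ κ₂ c₀ s₀ : ℝ) (Δ : ℝ → ℝ), 0 < a ∧ a < b ∧ b < 1 / 2 ∧ 0 < κ₁ ∧ κ₁ ≤ κ₂ ∧ 0 < c₀ ∧
      0 < s₀ ∧ (∀ U : ℝ, 0 < U → Real.exp (-(κ₂ / U ^ 2)) ≤ Δ U ∧ Δ U ≤ Real.exp (-(κ₁ / U ^ 2))) ∧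
      ∀ s : ℝ, s₀ ≤ s → ∃ U₁ : ℝ, 0 < U₁ ∧ ∀ δ ∈ Set.Icc a b, ∀ U ∈ Set.Ioo (0 : ℝ) U₁,
        ∀ (L : ℕ) [NeZero L], Even L → s₀ ≤ Δ U * L → Δ U * L ≤ s →
          ∀ ψ : Fock (Orb (FermionTorus 2 L)), star ψ ⬝ᵥ ψ = 1 →
            IsGroundStateInSector (hubbardTorus 2 L 1 0) (2 * ⌊(1 - δ) * (L : ℝ) ^ 2 / 2⌋₊) 0 ψ →
              c₀ * Δ U ^ 2 ≤
                (expect ((pairField dWaveFormFactor L)ᴴ * pairField dWaveFormFactor L) ψ).re /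
                  (L : ℝ) ^ 4 := by
  rintro ⟨a, b, κ₁, κ₂, c₀, s₀, Δ, ha, hab, hb, hκ₁, -, hc₀, hs₀, hpin, hwin⟩
  have hpin' : ∀ U : ℝ, 0 < U → 0 < Δ U ∧ Δ U ≤ Real.exp (-(κ₁ / U ^ 2)) := fun U hU =>
    ⟨lt_of_lt_of_le (Real.exp_pos _) (hpin U hU).1, (hpin U hU).2⟩
  obtain ⟨hs₀s, hdat⟩ := exists_window_datum hκ₁ hs₀ hc₀ hpin'
  obtain ⟨U₁, hU₁, hW⟩ := hwin _ hs₀s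
  obtain ⟨U, hUpos, hUU₁, m, hm2, hlo, hhi, hcontra⟩ := hdat U₁ hU₁
  haveI : NeZero (2 * m) := ⟨by omega⟩
  have hn : ⌊(1 - a) * ((2 * m : ℕ) : ℝ) ^ 2 / 2⌋₊ ≤ (2 * m) ^ 2 :=
    natFloor_filling_le_sq (by linarith) (2 * m)
  obtain ⟨ψ, hψ1, hgs, hP⟩ := exists_unit_free_groundState_pairDensity_le (by omega) hn
  exact hcontra _ hP
    (hW a ⟨le_rfl, hab.le⟩ U ⟨hUpos, hUU₁⟩ (2 * m) (even_two_mul m) hlo hhi ψ hψ1 hgs)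

/-- **The ground-state property is load-bearing.** With "ground state of `hubbardTorus 2 L 1 U`
in the sector `(2⌊(1-δ)L²/2⌋, S^z = 0)`" weakened to "unit vector of that sector" (everything
else — pins, window, `s`-uniform `c₀`, the coupling range — kept verbatim) the statement is
FALSE: the paired sea over any `⌊(1-δ)L²/2⌋` momenta is a unit vector of the sector with
`Re⟨Δ_d†Δ_d⟩ ≤ 32 L²` (`exists_unit_sector_state_pairDensity_le`), whatever `U` is. Sector and
density information alone carries no pair order at the window scale. [folklore] -/
theorem false_without_groundState :
    ¬ ∃ (a b κ₁ κ₂ c₀ s₀ : ℝ) (Δ : ℝ → ℝ), 0 < a ∧ a < b ∧ b < 1 / 2 ∧ 0 < κ₁ ∧ κ₁ ≤ κ₂ ∧ 0 < c₀ ∧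
      0 < s₀ ∧ (∀ U : ℝ, 0 < U → Real.exp (-(κ₂ / U ^ 2)) ≤ Δ U ∧ Δ U ≤ Real.exp (-(κ₁ / U ^ 2))) ∧
      ∀ s : ℝ, s₀ ≤ s → ∃ U₁ : ℝ, 0 < U₁ ∧ ∀ δ ∈ Set.Icc a b, ∀ U ∈ Set.Ioo (0 : ℝ) U₁,
        ∀ (L : ℕ) [NeZero L], Even L → s₀ ≤ Δ U * L → Δ U * L ≤ s →
          ∀ ψ : Fock (Orb (FermionTorus 2 L)), star ψ ⬝ᵥ ψ = 1 →
            ψ ∈ szSector (Λ := FermionTorus 2 L) (2 * ⌊(1 - δ) * (L : ℝ) ^ 2 / 2⌋₊) 0 →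
              c₀ * Δ U ^ 2 ≤
                (expect ((pairField dWaveFormFactor L)ᴴ * pairField dWaveFormFactor L) ψ).re /
                  (L : ℝ) ^ 4 := by
  rintro ⟨a, b, κ₁, κ₂, c₀, s₀, Δ, ha, hab, hb, hκ₁, -, hc₀, hs₀, hpin, hwin⟩
  have hpin' : ∀ U : ℝ, 0 < U → 0 < Δ U ∧ Δ U ≤ Real.exp (-(κ₁ / U ^ 2)) := fun U hU =>
    ⟨lt_of_lt_of_le (Real.exp_pos _) (hpin U hU).1, (hpin U hU).2⟩
  obtain ⟨hs₀s, hdat⟩ := exists_window_datum hκ₁ hs₀ hc₀ hpin'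
  obtain ⟨U₁, hU₁, hW⟩ := hwin _ hs₀s
  obtain ⟨U, hUpos, hUU₁, m, hm2, hlo, hhi, hcontra⟩ := hdat U₁ hU₁
  haveI : NeZero (2 * m) := ⟨by omega⟩
  have hn : ⌊(1 - a) * ((2 * m : ℕ) : ℝ) ^ 2 / 2⌋₊ ≤ (2 * m) ^ 2 :=
    natFloor_filling_le_sq (by linarith) (2 * m)
  obtain ⟨ψ, hψ1, hsec, hP⟩ := exists_unit_sector_state_pairDensity_le (L := 2 * m) hn
  exact hcontra _ hP
    (hW a ⟨le_rfl, hab.le⟩ U ⟨hUpos, hUU₁⟩ (2 * m) (even_two_mul m) hlo hhi ψ hψ1 hsec)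

/-- `Re⟨tψ, A (tψ)⟩ = t² Re⟨ψ, A ψ⟩` for a real scalar `t`. [folklore] -/
theorem re_expect_real_smul {ι : Type*} [LinearOrder ι] [Fintype ι]
    (A : Matrix (Finset ι) (Finset ι) ℂ) (t : ℝ) (ψ : Fock ι) :
    (expect A ((t : ℂ) • ψ)).re = t ^ 2 * (expect A ψ).re := by
  unfold expect
  rw [mulVec_smul, star_smul, smul_dotProduct, dotProduct_smul, smul_smul, smul_eq_mul,
    Complex.star_def, Complex.conj_ofReal, ← Complex.ofReal_mul, Complex.re_ofReal_mul]
  ring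

/-- **The normalisation is load-bearing.** Without `star ψ ⬝ᵥ ψ = 1` (everything else kept
verbatim, interacting torus included) the statement is FALSE: sector ground states of
`hubbardTorus 2 L 1 U` exist on every torus and form a cone
(`exists_unit_isGroundStateInSector_hubbardTorus`, `isGroundStateInSector_smul`), and scaling a
ground state `φ` by a small real `t` puts `Re⟨tφ, Δ_d†Δ_d (tφ)⟩ = t² Re⟨φ, Δ_d†Δ_d φ⟩`
(`re_expect_real_smul`) below the positive target `c₀ Δ(U)² L⁴`. [folklore] -/
theorem false_without_normalisation :
    ¬ ∃ (a b κ₁ κ₂ c₀ s₀ : ℝ) (Δ : ℝ → ℝ), 0 < a ∧ a < b ∧ b < 1 / 2 ∧ 0 < κ₁ ∧ κ₁ ≤ κ₂ ∧ 0 < c₀ ∧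
      0 < s₀ ∧ (∀ U : ℝ, 0 < U → Real.exp (-(κ₂ / U ^ 2)) ≤ Δ U ∧ Δ U ≤ Real.exp (-(κ₁ / U ^ 2))) ∧
      ∀ s : ℝ, s₀ ≤ s → ∃ U₁ : ℝ, 0 < U₁ ∧ ∀ δ ∈ Set.Icc a b, ∀ U ∈ Set.Ioo (0 : ℝ) U₁,
        ∀ (L : ℕ) [NeZero L], Even L → s₀ ≤ Δ U * L → Δ U * L ≤ s →
          ∀ ψ : Fock (Orb (FermionTorus 2 L)),
            IsGroundStateInSector (hubbardTorus 2 L 1 U) (2 * ⌊(1 - δ) * (L : ℝ) ^ 2 / 2⌋₊) 0 ψ →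
              c₀ * Δ U ^ 2 ≤
                (expect ((pairField dWaveFormFactor L)ᴴ * pairField dWaveFormFactor L) ψ).re /
                  (L : ℝ) ^ 4 := by
  rintro ⟨a, b, κ₁, κ₂, c₀, s₀, Δ, ha, hab, hb, hκ₁, -, hc₀, hs₀, hpin, hwin⟩
  have hpin' : ∀ U : ℝ, 0 < U → 0 < Δ U ∧ Δ U ≤ Real.exp (-(κ₁ / U ^ 2)) := fun U hU =>
    ⟨lt_of_lt_of_le (Real.exp_pos _) (hpin U hU).1, (hpin U hU).2⟩
  obtain ⟨hs₀s, hdat⟩ := exists_window_datum hκ₁ hs₀ hc₀ hpin'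
  obtain ⟨U₁, hU₁, hW⟩ := hwin _ hs₀s
  obtain ⟨U, hUpos, hUU₁, m, hm2, hlo, hhi, -⟩ := hdat U₁ hU₁
  have hDpos : 0 < Δ U := (hpin' U hUpos).1
  haveI : NeZero (2 * m) := ⟨by omega⟩
  have hn : ⌊(1 - a) * ((2 * m : ℕ) : ℝ) ^ 2 / 2⌋₊ ≤ (2 * m) ^ 2 :=
    natFloor_filling_le_sq (by linarith) (2 * m)
  -- a unit sector ground state `φ` of the interacting torus and its pair density `P`
  obtain ⟨φ, -, hgs⟩ := exists_unit_isGroundStateInSector_hubbardTorus U (2 * m) _ hn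
  set P : ℝ := (expect ((pairField dWaveFormFactor (2 * m))ᴴ * pairField dWaveFormFactor (2 * m))
    φ).re with hPdef
  -- the target `T = c₀ Δ² L⁴ > 0`; scale `φ` by `t` with `t² (|P| + 1) = T/2`
  set T : ℝ := c₀ * Δ U ^ 2 * ((2 * m : ℕ) : ℝ) ^ 4 with hTdef
  have hL4 : (0 : ℝ) < ((2 * m : ℕ) : ℝ) ^ 4 := by positivity
  have hTpos : 0 < T := by positivity
  have hP1 : 0 < |P| + 1 := by positivity
  set t : ℝ := Real.sqrt (T / (2 * (|P| + 1))) with htdef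
  have htpos : 0 < t := Real.sqrt_pos.2 (by positivity)
  have ht2 : t ^ 2 = T / (2 * (|P| + 1)) := Real.sq_sqrt (by positivity)
  have hgs' : IsGroundStateInSector (hubbardTorus 2 (2 * m) 1 U)
      (2 * ⌊(1 - a) * ((2 * m : ℕ) : ℝ) ^ 2 / 2⌋₊) 0 (((t : ℝ) : ℂ) • φ) :=
    isGroundStateInSector_smul hgs (by exact_mod_cast htpos.ne')
  have key := hW a ⟨le_rfl, hab.le⟩ U ⟨hUpos, hUU₁⟩ (2 * m) (even_two_mul m) hlo hhi _ hgs'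
  rw [le_div_iff₀ hL4, re_expect_real_smul] at key
  have h1 : t ^ 2 * P ≤ t ^ 2 * |P| := mul_le_mul_of_nonneg_left (le_abs_self P) (sq_nonneg t)
  have h2 : t ^ 2 * |P| < T := by
    rw [ht2]
    have h3 : T / (2 * (|P| + 1)) * |P| < T / (2 * (|P| + 1)) * (2 * (|P| + 1)) := by
      apply mul_lt_mul_of_pos_left _ (by positivity)
      linarith [abs_nonneg P]
    rwa [div_mul_cancel₀ T (by positivity)] at h3
  have hT : T ≤ t ^ 2 * P := key
  linarith

/-- **Registered stub `loadBearingInteraction` (crux `stmt-HubbardSuperconductivity-1319`, line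
`birth`).** One-line registered form of `false_without_interaction`: the free-torus analogue of
`CoherenceWindowLRO` is false. [folklore] -/
theorem loadBearingInteraction : ¬ ∃ (a b κ₁ κ₂ c₀ s₀ : ℝ) (Δ : ℝ → ℝ), 0 < a ∧ a < b ∧ b < 1 / 2 ∧ 0 < κ₁ ∧ κ₁ ≤ κ₂ ∧ 0 < c₀ ∧ 0 < s₀ ∧ (∀ U : ℝ, 0 < U → Real.exp (-(κ₂ / U ^ 2)) ≤ Δ U ∧ Δ U ≤ Real.exp (-(κ₁ / U ^ 2))) ∧ ∀ s : ℝ, s₀ ≤ s → ∃ U₁ : ℝ, 0 < U₁ ∧ ∀ δ ∈ Set.Icc a b, ∀ U ∈ Set.Ioo (0 : ℝ) U₁, ∀ (L : ℕ) [NeZero L], Even L → s₀ ≤ Δ U * L → Δ U * L ≤ s → ∀ ψ : Literature.MathematicalPhysics.QuantumLattice.Fock (Literature.MathematicalPhysics.QuantumLattice.Orb (Literature.MathematicalPhysics.QuantumLattice.FermionTorus 2 L)), star ψ ⬝ᵥ ψ = 1 → Literature.MathematicalPhysics.QuantumLattice.IsGroundStateInSector (Literature.MathematicalPhysics.QuantumLattice.hubbardTorus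 2 L 1 0) (2 * ⌊(1 - δ) * (L : ℝ) ^ 2 / 2⌋₊) 0 ψ → c₀ * Δ U ^ 2 ≤ (Literature.MathematicalPhysics.QuantumLattice.expect ((Literature.MathematicalPhysics.QuantumLattice.pairField Literature.MathematicalPhysics.QuantumLattice.dWaveFormFactor L)ᴴ * Literature.MathematicalPhysics.QuantumLattice.pairField Literature.MathematicalPhysics.QuantumLattice.dWaveFormFactor L) ψ).re / (L : ℝ) ^ 4 :=
  false_without_interaction

end Summit.HubbardSuperconductivity.HubbardSuperconductivity.Theorems.CoherenceWindowLRO.Negative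

end
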